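import Mathlib.NumberTheory.Padics.Complex
import Summits.BirchSwinnertonDyer.BirchSwinnertonDyer.Theorems.ResidualThetaTransportAtTwoThetaLayerLambdaCongruenceAtTwoLayerAlgebra
import Literature.NumberTheory.LFunctions.PadicRootsOfUnitySeparation
import HarnessLib

/-!
# Layer algebra, part 2, for crux `ThetaLayerLambdaCongruenceAtTwo` (stmt-BirchSwinnertonDyer-20688, route
# ResidualThetaTransportAtTwo): the layer modulus `ω_n = (X+1)^{pⁿ} − 1` over `ℚ̄_p` and the layer product rule
# at that modulus (lead prover bsd-wall-rtt-p3 g0; `--supports stmt-BirchSwinnertonDyer-20688 --as helper`)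

HONEST FRAMING. Pure normed algebra over `PadicAlgCl p`; nothing about any curve or form is asserted; BSD is not
proved by any of this. Companion of `…ThetaLayerLambdaCongruenceAtTwoLayerAlgebra.lean` (Gauss's lemma with `λ`,
reduction modulo an integral monic modulus close to `X^m`): here the modulus of the crux's layer elements,
`ω_n = (X+1)^{pⁿ} − 1 ∈ ℚ̄_p[X]` (the crux reduces `%ₘ ((X + 1) ^ 2 ^ n - 1)`), is shown to be monic of degree
`pⁿ`, integral, with `‖ω_n − X^{pⁿ}‖_sup ≤ p⁻¹ < 1` (the binomial coefficients `C(pⁿ, i)`, `0 < i < pⁿ`, are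
divisible by `p`, `Nat.Prime.dvd_choose_pow`), whence the LAYER PRODUCT RULE at `ω_n`:
`λ((θ·P) %ₘ ω_n) = λθ + λP` and `‖(θ·P) %ₘ ω_n‖_sup = ‖θ‖_sup‖P‖_sup` for `θ, P ≠ 0` with `λθ + λP < pⁿ`, and
`λ(F %ₘ ω_n) = λ(F)`, `‖F %ₘ ω_n‖_sup = ‖F‖_sup` for `F ≠ 0` with `λ(F) < pⁿ` (Pollack–Weston §3.1 bookkeeping).

References: [PollackWeston2011MT] §3.1; [Washington1997] §7.1.
-/

noncomputable section

-- justification: the `Summit.BirchSwinnertonDyer.BirchSwinnertonDyer.…` path repeats a component (route-file convention)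
set_option linter.dupNamespace false

open Polynomial

open Literature.NumberTheory.IwasawaTheory

namespace Summit.BirchSwinnertonDyer.BirchSwinnertonDyer.Theorems.ThetaLayerLambdaCongruenceAtTwo

/-! ## The layer modulus `ω_n = (X+1)^{pⁿ} − 1` over `ℚ̄_p` -/

section Omega

variable {p : ℕ} [Fact p.Prime]

/-- The norm of a natural number divisible by `p` in `ℚ̄_p` is at most `p⁻¹`. [folklore] -/
theorem norm_natCast_padicAlgCl_le_inv_of_dvd {m : ℕ} (h : p ∣ m) : ‖(m : PadicAlgCl p)‖ ≤ (p : ℝ)⁻¹ := by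
  obtain ⟨k, rfl⟩ := h
  rw [Nat.cast_mul, norm_mul]
  have hp : ‖((p : ℕ) : PadicAlgCl p)‖ = (p : ℝ)⁻¹ := by
    rw [← map_natCast (algebraMap ℚ_[p] (PadicAlgCl p)) p]
    change ‖((p : ℚ_[p]) : PadicAlgCl p)‖ = (p : ℝ)⁻¹
    rw [PadicAlgCl.norm_extends, Padic.norm_p]
  rw [hp]
  calc (p : ℝ)⁻¹ * ‖(k : PadicAlgCl p)‖ ≤ (p : ℝ)⁻¹ * 1 :=
        mul_le_mul_of_nonneg_left (Literature.NumberTheory.LFunctions.PadicRootsOfUnity.norm_natCast_le_one k)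
          (inv_nonneg.mpr (Nat.cast_nonneg p))
    _ = (p : ℝ)⁻¹ := mul_one _

/-- `ω_n = (X+1)^{pⁿ} − 1 ∈ ℚ̄_p[X]` is monic. [folklore] -/
theorem monic_layerModulus (n : ℕ) : ((X + 1) ^ p ^ n - 1 : (PadicAlgCl p)[X]).Monic := by
  have hX : (X + 1 : (PadicAlgCl p)[X]) = X + C 1 := by rw [C_1]
  have h1 : ((X + 1 : (PadicAlgCl p)[X]) ^ p ^ n).Monic := by rw [hX]; exact (monic_X_add_C 1).pow _
  apply h1.sub_of_left
  rw [degree_one, degree_eq_natDegree h1.ne_zero, hX, natDegree_pow, natDegree_X_add_C, mul_one]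
  exact_mod_cast pow_pos (Fact.out : p.Prime).pos n

/-- `deg ω_n = pⁿ`. [folklore] -/
theorem natDegree_layerModulus (n : ℕ) : ((X + 1) ^ p ^ n - 1 : (PadicAlgCl p)[X]).natDegree = p ^ n := by
  have hpos : 0 < p ^ n := pow_pos (Fact.out : p.Prime).pos n
  have hX : (X + 1 : (PadicAlgCl p)[X]) = X + C 1 := by rw [C_1]
  have hdeg : ((X + 1 : (PadicAlgCl p)[X]) ^ p ^ n).natDegree = p ^ n := by
    rw [hX, natDegree_pow, natDegree_X_add_C, mul_one]
  rw [natDegree_sub_eq_left_of_natDegree_lt, hdeg]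
  rw [hdeg, natDegree_one]
  exact hpos

/-- The coefficients of `ω_n − X^{pⁿ}`: `C(pⁿ, i)` for `0 < i < pⁿ`, and `0` otherwise. [folklore] -/
theorem coeff_layerModulus_sub_X_pow (n i : ℕ) :
    ((X + 1) ^ p ^ n - 1 - X ^ p ^ n : (PadicAlgCl p)[X]).coeff i =
      if i = 0 ∨ i = p ^ n then 0 else ((p ^ n).choose i : PadicAlgCl p) := by
  have hpos : p ^ n ≠ 0 := (pow_pos (Fact.out : p.Prime).pos n).ne'
  rw [coeff_sub, coeff_sub, coeff_X_add_one_pow, coeff_one, coeff_X_pow]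
  by_cases h0 : i = 0
  · subst h0
    rw [if_pos rfl, if_neg (Ne.symm hpos), if_pos (Or.inl rfl), Nat.choose_zero_right, Nat.cast_one, sub_self,
      sub_zero]
  by_cases hN : i = p ^ n
  · subst hN
    rw [if_neg h0, if_pos rfl, if_pos (Or.inr rfl), Nat.choose_self, Nat.cast_one, sub_zero, sub_self]
  rw [if_neg h0, if_neg hN, if_neg (not_or.mpr ⟨h0, hN⟩), sub_zero, sub_zero]

/-- `‖ω_n − X^{pⁿ}‖_sup ≤ p⁻¹`: the middle binomial coefficients `C(pⁿ, i)`, `0 < i < pⁿ`, are divisible by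
`p` (`Nat.Prime.dvd_choose_pow`). [folklore] -/
theorem supNorm_layerModulus_sub_X_pow_le (n : ℕ) :
    ((X + 1) ^ p ^ n - 1 - X ^ p ^ n : (PadicAlgCl p)[X]).supNorm ≤ (p : ℝ)⁻¹ := by
  obtain ⟨i, hi⟩ := ((X + 1) ^ p ^ n - 1 - X ^ p ^ n : (PadicAlgCl p)[X]).exists_eq_supNorm
  rw [hi, coeff_layerModulus_sub_X_pow]
  split_ifs with h
  · rw [norm_zero]; exact inv_nonneg.mpr (Nat.cast_nonneg p)
  · push Not at h
    exact norm_natCast_padicAlgCl_le_inv_of_dvd ((Fact.out : p.Prime).dvd_choose_pow h.1 h.2)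

/-- `‖ω_n − X^{pⁿ}‖_sup < 1`. [folklore] -/
theorem supNorm_layerModulus_sub_X_pow_lt_one (n : ℕ) :
    ((X + 1) ^ p ^ n - 1 - X ^ ((X + 1) ^ p ^ n - 1 : (PadicAlgCl p)[X]).natDegree : (PadicAlgCl p)[X]).supNorm
      < 1 := by
  rw [natDegree_layerModulus]
  refine (supNorm_layerModulus_sub_X_pow_le n).trans_lt ?_
  have hp : (1 : ℝ) < p := by exact_mod_cast (Fact.out : p.Prime).one_lt
  exact inv_lt_one_of_one_lt₀ hp

/-- `‖ω_n‖_sup ≤ 1` (integral coefficients). [folklore] -/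
theorem supNorm_layerModulus_le_one (n : ℕ) : ((X + 1) ^ p ^ n - 1 : (PadicAlgCl p)[X]).supNorm ≤ 1 := by
  obtain ⟨i, hi⟩ := ((X + 1) ^ p ^ n - 1 : (PadicAlgCl p)[X]).exists_eq_supNorm
  rw [hi, coeff_sub, coeff_X_add_one_pow, coeff_one]
  split_ifs
  · rw [sub_eq_add_neg]
    refine (IsUltrametricDist.norm_add_le_max _ _).trans
      (max_le (Literature.NumberTheory.LFunctions.PadicRootsOfUnity.norm_natCast_le_one _) ?_)
    rw [norm_neg, norm_one]
  · rw [sub_zero]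
    exact Literature.NumberTheory.LFunctions.PadicRootsOfUnity.norm_natCast_le_one _

/-- **The layer product rule at the modulus of the crux**: over `ℚ̄_p`, for non-zero `θ, P` with
`λθ + λP < pⁿ`, `λ((θ·P) %ₘ ω_n) = λθ + λP` and `‖(θ·P) %ₘ ω_n‖_sup = ‖θ‖_sup·‖P‖_sup`, `ω_n = (X+1)^{pⁿ} − 1`.
[cite: PollackWeston2011MT, §3.1] -/
theorem layerLambda_mul_modByMonic_layerModulus (n : ℕ) {θ P : (PadicAlgCl p)[X]} (hθ : θ ≠ 0) (hP : P ≠ 0)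
    (hlam : layerLambda θ + layerLambda P < p ^ n) :
    layerLambda ((θ * P) %ₘ ((X + 1) ^ p ^ n - 1)) = layerLambda θ + layerLambda P ∧
      ((θ * P) %ₘ ((X + 1) ^ p ^ n - 1)).supNorm = θ.supNorm * P.supNorm :=
  layerLambda_mul_modByMonic (monic_layerModulus n) (supNorm_layerModulus_le_one n)
    (supNorm_layerModulus_sub_X_pow_lt_one n) hθ hP (by rwa [natDegree_layerModulus])

/-- **`λ` and `μ` survive the reduction modulo `ω_n`** when `λ < pⁿ`: `λ(F %ₘ ω_n) = λ(F)`,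
`‖F %ₘ ω_n‖_sup = ‖F‖_sup` for `F ≠ 0` with `λ(F) < pⁿ`. [cite: PollackWeston2011MT, §3.1] -/
theorem layerLambda_modByMonic_layerModulus (n : ℕ) {F : (PadicAlgCl p)[X]} (hF : F ≠ 0)
    (hlam : layerLambda F < p ^ n) :
    (F %ₘ ((X + 1) ^ p ^ n - 1)).supNorm = F.supNorm ∧
      layerLambda (F %ₘ ((X + 1) ^ p ^ n - 1)) = layerLambda F :=
  supNorm_modByMonic_eq_and_layerLambda_modByMonic_eq (monic_layerModulus n) (supNorm_layerModulus_le_one n)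
    (supNorm_layerModulus_sub_X_pow_lt_one n) hF (by rwa [natDegree_layerModulus])

end Omega

end Summit.BirchSwinnertonDyer.BirchSwinnertonDyer.Theorems.ThetaLayerLambdaCongruenceAtTwo

end
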